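import Literature.MeasureTheory.Group.LatticeCovolumeDescent
import Literature.NumberTheory.Automorphic.UnitaryGroupHermitianOrbitCount
import Literature.NumberTheory.Automorphic.QuasiSplitUnitaryAutomorphicMeasure
import Literature.NumberTheory.Automorphic.LatticeUnimodular
import HarnessLib

/-!
# Finite covolume of `U(H)(L⁺)` in `U(H)(𝔸_{L⁺})` by descent from the reduction theory of `GL_N(𝔸_L)`
# (Borel–Harish-Chandra by orbit-count unfolding), and the automorphic measure of `U(H)`

Topic `NumberTheory/Automorphic`; namespace `Literature.NumberTheory.Automorphic.UnitaryGroup`.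
Proof file: theorems only, no definition, no named fact, no `sorry`; imports = tree + Mathlib.

Setting: `L` a CM number field (`c` its conjugation, `L⁺` the maximal real subfield), `H ∈ M_N(L)`
HERMITIAN (`(H^c)ᵀ = H`) and non-degenerate (`det H ≠ 0`), `U = U(H)(𝔸_{L⁺}) =
adelicUnitaryGroup L H ≤ R = GL_N(𝔸_L)` (closed; the stabiliser of `H_𝔸`), `Γ = GL_N(L)`
(`rationalPointsGL`, discrete), `Λ = Γ ∩ U = U(H)(L⁺)` (`adelicUnitaryRat`). The tree has
REDUCTION THEORY FOR `GL_N` over `L` (`reductionTheory_gl_holds`, band form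
`normBand_subset_iUnion_smul_left`), the abstract ORBIT-COUNT UNFOLDING
(`Literature.MeasureTheory.Group.measure_fundamentalDomain_lt_top_of_lintegral_encard_lt_top`:
`ν(F_U) μ(P) ≤ ν(U ∩ PP⁻¹) ∫_{F_R} #τ{γ : γ g ∈ U P} dμ`) and the hermitian orbit count
(`UnitaryGroupHermitianOrbitCount`). This file assembles Borel–Harish-Chandra's finiteness theorem
for `U(H)`:

* **`measure_lt_top_of_orbitCount`** — FINITE COVOLUME `ν(F_U) < ∞` of `U(H)(L⁺)` in
  `U(H)(𝔸_{L⁺})`, GIVEN the Siegel-set integrability of the hermitian orbit count (hypothesis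
  `hcount` — reduction theory's box count, the export of the counting files of the S3 plan):
  unfolding + domination of the band integral by the Siegel-set integral;
* **`exists_isAutomorphicMeasure_cmDatum_of_orbitCount`** — hence (lattice ⇒ unimodular, tree
  `modularCharacterFun_eq_one_of_isFundamentalDomain`; cover `F_U⁻¹ Λ = U`) an AUTOMORPHIC MEASURE on
  `U(H)(L⁺)\U(H)(𝔸_{L⁺})` for EVERY non-degenerate hermitian `H` and every `N`, through the
  covering-set socket `exists_isAutomorphicMeasure_cmDatum_of_cover`. For the quasi-split `U(Φ_N)`
  this is stub S3 of the crux line `F0_T1InnerFormTraceIdentity` (H413) modulo `hcount`.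

## References

* A. Borel, Harish-Chandra, *Arithmetic subgroups of algebraic groups*, Ann. of Math. 75 (1962),
  §7 Thm. 7.8, §9 Lemma 9.4. [BorelHarishChandra1962]
* A. Borel, *Some finiteness properties of adele groups over number fields*, Publ. Math. IHÉS 16
  (1963), §5 Thm. 5.8. [Borel1963]
* R. Godement, *Domaines fondamentaux des groupes arithmétiques*, Sém. Bourbaki 257, §4, §8.
  [Godement1964]
* V. Platonov, A. Rapinchuk, *Algebraic Groups and Number Theory* (1994), Thm. 4.17, §5.3.
  [PlatonovRapinchuk1994]
-/

set_option autoImplicit false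

noncomputable section

open MeasureTheory Measure NumberField IsDedekindDomain Matrix Set
open scoped MatrixGroups NNReal ENNReal Pointwise

namespace Literature.NumberTheory.Automorphic

namespace UnitaryGroup

open Literature.Topology.Algebra Literature.MeasureTheory.Group

variable (L : Type) [Field L] [NumberField L] [IsCMField L] (N : ℕ) (H : Matrix (Fin N) (Fin N) L)

/-! ## §1 Finite covolume of `U(H)(L⁺)` from the Siegel-set integrability of the orbit count -/

variable {L N H} in
/-- **Finite covolume of `U(H)(L⁺)` in `U(H)(𝔸_{L⁺})` by orbit-count unfolding** (Borel–Harish-Chandra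
for the unitary group, descended from the reduction theory of `GL_N(𝔸_L)`). Let `H` be hermitian
non-degenerate, `ν` a Haar measure on `U(H)(𝔸)` (Borel structure), `F_U` a measurable fundamental
domain for the left action of `U(H)(L⁺)`. ASSUME the hermitian orbit count
`g ↦ #{h ∈ M_N(L) hermitian : (cg)ᵀ h_𝔸 g ∈ B}` is integrable over every thickened Siegel set
`Z Ω A_t K` of `GL_N(𝔸_L)` for every compact `B` (`hcount` — reduction theory's box count, the
counting files of the S3 plan). Then `ν(F_U) < ∞`. Proof: choose a compact `P ∋ 1` inside the norm
band with `μ(P) > 0`; the unfolding inequality bounds `ν(F_U) μ(P)` by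
`ν(U ∩ PP⁻¹) ∫_{F_R} #τ{γ : γ g ∈ U P}`; the integrand is `≤` the hermitian orbit count for
`B = H_𝔸 · P` (`encard_image_conjAct_le`), vanishes off the norm band (`mem_normBand_of_mul_mem`),
and the band integral of the `Γ`-invariant count is dominated by its Siegel-set integral
(`normBand_subset_iUnion_smul_left`, `setLIntegral_inter_le_of_subset_iUnion_smul`), finite by
`hcount`. [cite: BorelHarishChandra1962, §7 Thm. 7.8] [cite: Borel1963, §5 Thm. 5.8] -/
theorem measure_lt_top_of_orbitCount (hH : (H.map (cmConjRingHom L))ᵀ = H) (hdet : H.det ≠ 0)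
    (hcount : ∀ (_ : MeasurableSpace (GL (Fin N) (AdeleRing (𝓞 L) L)))
      (_ : BorelSpace (GL (Fin N) (AdeleRing (𝓞 L) L)))
      (μ : Measure (GL (Fin N) (AdeleRing (𝓞 L) L))) (_ : μ.IsHaarMeasure)
      (B : Set (Matrix (Fin N) (Fin N) (AdeleRing (𝓞 L) L))), IsCompact B →
      ∀ (Ω : Set (GL (Fin N) (AdeleRing (𝓞 L) L))) (t : ℝ) (Z : Set (GL (Fin N) (AdeleRing (𝓞 L) L))),
        0 < t → IsCompact Ω →
        Ω ⊆ (standardParabolicGL (AdeleRing (𝓞 L) L) (id : Fin N → Fin N) :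
          Set (GL (Fin N) (AdeleRing (𝓞 L) L))) →
        IsCompact Z → Z ⊆ Set.range (posRealScalar N L) →
        ∫⁻ g in Z * (Ω * siegelCone N L t *
            (standardMaximalCompactGL N L : Set (GL (Fin N) (AdeleRing (𝓞 L) L)))),
          (({h : Matrix (Fin N) (Fin N) L | (h.map (cmConjRingHom L))ᵀ = h ∧
              (Godement.conjAct L).act (h.map (algebraMap L (AdeleRing (𝓞 L) L))) g ∈ B}.ncard :
                ℕ) : ℝ≥0∞) ∂μ < ⊤)
    [MeasurableSpace (adelicUnitaryGroup L H)] [BorelSpace (adelicUnitaryGroup L H)]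
    (ν : Measure (adelicUnitaryGroup L H)) [ν.IsHaarMeasure]
    {F_U : Set (adelicUnitaryGroup L H)} (hFUm : MeasurableSet F_U)
    (hFU : IsFundamentalDomain (adelicUnitaryRat L H) F_U ν) : ν F_U < ∞ := by
  classical
  -- the ambient group `R = GL_N(𝔸_L)`
  letI mR : MeasurableSpace (GL (Fin N) (AdeleRing (𝓞 L) L)) := borel _
  haveI bR : BorelSpace (GL (Fin N) (AdeleRing (𝓞 L) L)) := ⟨rfl⟩
  haveI : T2Space (GL (Fin N) (AdeleRing (𝓞 L) L)) := t2Space_gl N L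
  haveI : LocallyCompactSpace (GL (Fin N) (AdeleRing (𝓞 L) L)) :=
    AdelicGroupData.locallyCompactSpace_generalLinearGroup_adeleRing L (Fin N)
  haveI : SecondCountableTopology (GL (Fin N) (AdeleRing (𝓞 L) L)) :=
    secondCountableTopology_generalLinearGroup_adeleRing L (Fin N)
  set μ : Measure (GL (Fin N) (AdeleRing (𝓞 L) L)) := haar with hμ
  -- the closed subgroup `U` and its rational points
  have hUc : IsClosed (adelicUnitaryGroup L H : Set (GL (Fin N) (AdeleRing (𝓞 L) L))) :=
    isClosed_adelicUnitaryGroup L H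
  haveI : DiscreteTopology (rationalPointsGL N L) := gl_isDiscreteRational_holds N L
  haveI : Countable (rationalPointsGL N L) := countable_rationalPointsGL N L
  haveI : Countable (adelicUnitaryRat L H) := by
    haveI : SecondCountableTopology (adelicUnitaryRat L H) :=
      TopologicalSpace.Subtype.secondCountableTopology _
    exact countable_of_Lindelof_of_discrete
  obtain ⟨F_R, -, hFR⟩ :=
    Literature.MeasureTheory.Group.Subgroup.exists_isFundamentalDomain_of_discrete
      (rationalPointsGL N L) μ
  -- a compact neighbourhood `P` of `1` inside the norm band, of positive measure
  obtain ⟨P₀, hP₀c, hP₀1⟩ := exists_compact_mem_nhds (1 : GL (Fin N) (AdeleRing (𝓞 L) L))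
  set P : Set (GL (Fin N) (AdeleRing (𝓞 L) L)) := P₀ ∩ normBand N L with hP
  have hPc : IsCompact P := hP₀c.inter_right (isClosed_normBand N L)
  have hPD : P ⊆ normBand N L := Set.inter_subset_right
  have hP0 : μ P ≠ 0 := by
    -- `P ⊇ interior P₀ ∩ {1/2 < |det| < 2}`, an open set containing `1`
    set O : Set (GL (Fin N) (AdeleRing (𝓞 L) L)) := interior P₀ ∩
      ((fun g => ((glAbsDet N L g : ℝ≥0) : ℝ)) ⁻¹' Set.Ioo (1 / 2) 2) with hO
    have hOo : IsOpen O :=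
      isOpen_interior.inter (isOpen_Ioo.preimage (continuous_glAbsDet_real N L))
    have h1O : (1 : GL (Fin N) (AdeleRing (𝓞 L) L)) ∈ O := by
      refine ⟨mem_interior_iff_mem_nhds.2 hP₀1, ?_⟩
      change ((glAbsDet N L 1 : ℝ≥0) : ℝ) ∈ Set.Ioo (1 / 2 : ℝ) 2
      rw [map_one, Units.val_one, NNReal.coe_one]
      norm_num
    have hOP : O ⊆ P := fun g hg => ⟨interior_subset hg.1, ⟨hg.2.1.le, hg.2.2.le⟩⟩
    exact fun h0 => (hOo.measure_pos μ ⟨1, h1O⟩).ne' (measure_mono_null hOP h0)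
  -- the class map
  have hΛ : ∀ u : adelicUnitaryGroup L H, u ∈ adelicUnitaryRat L H ↔
      (u : GL (Fin N) (AdeleRing (𝓞 L) L)) ∈ rationalPointsGL N L :=
    mem_adelicUnitaryRat_iff_mem_rationalPointsGL L N H
  have hτ : ∀ γ γ' : rationalPointsGL N L,
      (Godement.conjAct L).act (H.map (algebraMap L (AdeleRing (𝓞 L) L)))
          (γ : GL (Fin N) (AdeleRing (𝓞 L) L)) =
        (Godement.conjAct L).act (H.map (algebraMap L (AdeleRing (𝓞 L) L)))
          (γ' : GL (Fin N) (AdeleRing (𝓞 L) L)) ↔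
      (γ' : GL (Fin N) (AdeleRing (𝓞 L) L)) * ((γ : GL (Fin N) (AdeleRing (𝓞 L) L)))⁻¹ ∈
        adelicUnitaryGroup L H := fun γ γ' => conjAct_eq_conjAct_iff L N H _ _
  -- the orbit-count integral over `F_R` is finite
  obtain ⟨Ω, t, Z, ht, hΩc, hΩB, hZc, hZr, hDsub⟩ := normBand_subset_iUnion_smul_left L N
  set B : Set (Matrix (Fin N) (Fin N) (AdeleRing (𝓞 L) L)) :=
    (fun p : GL (Fin N) (AdeleRing (𝓞 L) L) =>
      (Godement.conjAct L).act (H.map (algebraMap L (AdeleRing (𝓞 L) L))) p) '' P with hB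
  have hBc : IsCompact B := hPc.image (Godement.continuous_conjAct L _)
  have hT5 := hcount mR bR μ inferInstance B hBc Ω t Z ht hΩc hΩB hZc hZr
  -- the `Γ`-invariant majorant `Θ`
  set Θ : GL (Fin N) (AdeleRing (𝓞 L) L) → ℝ≥0∞ := fun g =>
    ({h : Matrix (Fin N) (Fin N) L | (h.map (cmConjRingHom L))ᵀ = h ∧
      (Godement.conjAct L).act (h.map (algebraMap L (AdeleRing (𝓞 L) L))) g ∈ B}.encard : ℝ≥0∞)
    with hΘ
  have hΘinv : ∀ (γ : rationalPointsGL N L) (g : GL (Fin N) (AdeleRing (𝓞 L) L)),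
      Θ ((γ : GL (Fin N) (AdeleRing (𝓞 L) L)) * g) = Θ g := fun γ g => by
    simp only [hΘ]
    rw [encard_hermitianOrbitSet_mul_left B γ.2 g]
  have hΘeq : ∀ g, Θ g = (({h : Matrix (Fin N) (Fin N) L | (h.map (cmConjRingHom L))ᵀ = h ∧
      (Godement.conjAct L).act (h.map (algebraMap L (AdeleRing (𝓞 L) L))) g ∈ B}.ncard : ℕ) :
        ℝ≥0∞) := fun g => by
    simp only [hΘ]
    rw [← (finite_hermitianOrbitSet L N hBc g).cast_ncard_eq, ENat.toENNReal_coe]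
  have hint : ∫⁻ g in F_R, ((((fun γ : rationalPointsGL N L =>
        (Godement.conjAct L).act (H.map (algebraMap L (AdeleRing (𝓞 L) L)))
          (γ : GL (Fin N) (AdeleRing (𝓞 L) L))) ''
        {γ : rationalPointsGL N L | (γ : GL (Fin N) (AdeleRing (𝓞 L) L)) * g ∈
          (adelicUnitaryGroup L H : Set (GL (Fin N) (AdeleRing (𝓞 L) L))) * P}).encard : ℝ≥0∞)) ∂μ <
      ∞ := by
    -- pointwise: `≤ 𝟙_D · Θ`
    have hpt : ∀ g, ((((fun γ : rationalPointsGL N L =>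
        (Godement.conjAct L).act (H.map (algebraMap L (AdeleRing (𝓞 L) L)))
          (γ : GL (Fin N) (AdeleRing (𝓞 L) L))) ''
        {γ : rationalPointsGL N L | (γ : GL (Fin N) (AdeleRing (𝓞 L) L)) * g ∈
          (adelicUnitaryGroup L H : Set (GL (Fin N) (AdeleRing (𝓞 L) L))) * P}).encard : ℝ≥0∞)) ≤
        (normBand N L).indicator Θ g := by
      intro g
      by_cases hg : g ∈ normBand N L
      · rw [Set.indicator_of_mem hg]
        simp only [hΘ]
        exact ENat.toENNReal_le.2 (encard_image_conjAct_le hH P g)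
      · rw [Set.indicator_of_notMem hg]
        have hempty : {γ : rationalPointsGL N L | (γ : GL (Fin N) (AdeleRing (𝓞 L) L)) * g ∈
            (adelicUnitaryGroup L H : Set (GL (Fin N) (AdeleRing (𝓞 L) L))) * P} = ∅ :=
          Set.eq_empty_of_forall_notMem fun γ hγ => hg (mem_normBand_of_mul_mem hdet hPD γ.2 hγ)
        rw [hempty, Set.image_empty, Set.encard_empty]
        simp
    calc _ ≤ ∫⁻ g in F_R, (normBand N L).indicator Θ g ∂μ := lintegral_mono fun g => hpt g
      _ = ∫⁻ g in F_R ∩ normBand N L, Θ g ∂μ := by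
          rw [lintegral_indicator (isClosed_normBand N L).measurableSet,
            Measure.restrict_restrict (isClosed_normBand N L).measurableSet, Set.inter_comm]
      _ ≤ ∫⁻ g in Z * (Ω * siegelCone N L t *
            (standardMaximalCompactGL N L : Set (GL (Fin N) (AdeleRing (𝓞 L) L)))), Θ g ∂μ :=
          setLIntegral_inter_le_of_subset_iUnion_smul (rationalPointsGL N L) μ hFR hΘinv hDsub
      _ = ∫⁻ g in Z * (Ω * siegelCone N L t *
            (standardMaximalCompactGL N L : Set (GL (Fin N) (AdeleRing (𝓞 L) L)))),
            (({h : Matrix (Fin N) (Fin N) L | (h.map (cmConjRingHom L))ᵀ = h ∧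
              (Godement.conjAct L).act (h.map (algebraMap L (AdeleRing (𝓞 L) L))) g ∈ B}.ncard :
                ℕ) : ℝ≥0∞) ∂μ := lintegral_congr fun g => hΘeq g
      _ < ∞ := hT5
  -- the unfolding inequality
  haveI : LocallyCompactSpace (adelicUnitaryGroup L H) := inferInstance
  exact measure_fundamentalDomain_lt_top_of_lintegral_encard_lt_top (adelicUnitaryGroup L H) hUc μ ν
    (rationalPointsGL N L) hFR (adelicUnitaryRat L H) hΛ hFU hFUm hPc hP0 _ hτ hint

/-! ## §2 The automorphic measure of `U(H)` -/

variable {L N H} in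
/-- **Automorphic measure on `U(H)(L⁺)\U(H)(𝔸_{L⁺})` for every non-degenerate hermitian `H`, from the
Siegel-set integrability of the hermitian orbit count.** With `F_U` a strict Borel fundamental domain
of `U(H)(L⁺)` acting on the left of `U(H)(𝔸)` (tree `Subgroup.exists_measurableSet_existsUnique_smul_mem`):
`0 < ν(F_U) < ∞` (§2), hence `U(H)(𝔸)` is unimodular (tree `isMulRightInvariant_of_isFundamentalDomain`,
`modularCharacterFun_eq_one_of_isFundamentalDomain`), `ν(F_U⁻¹) = ν(F_U) < ∞`, `F_U⁻¹ · U(H)(L⁺) = U(H)(𝔸)`,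
and the covering-set constructor `exists_isAutomorphicMeasure_cmDatum_of_cover` applies.
[cite: BorelHarishChandra1962, §7 Thm. 7.8] [cite: Borel1963, §5 Thm. 5.8]
[cite: PlatonovRapinchuk1994, Thm. 4.17] -/
theorem exists_isAutomorphicMeasure_cmDatum_of_orbitCount (hH : (H.map (cmConjRingHom L))ᵀ = H)
    (hdet : H.det ≠ 0)
    (hcount : ∀ (_ : MeasurableSpace (GL (Fin N) (AdeleRing (𝓞 L) L)))
      (_ : BorelSpace (GL (Fin N) (AdeleRing (𝓞 L) L)))
      (μ : Measure (GL (Fin N) (AdeleRing (𝓞 L) L))) (_ : μ.IsHaarMeasure)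
      (B : Set (Matrix (Fin N) (Fin N) (AdeleRing (𝓞 L) L))), IsCompact B →
      ∀ (Ω : Set (GL (Fin N) (AdeleRing (𝓞 L) L))) (t : ℝ) (Z : Set (GL (Fin N) (AdeleRing (𝓞 L) L))),
        0 < t → IsCompact Ω →
        Ω ⊆ (standardParabolicGL (AdeleRing (𝓞 L) L) (id : Fin N → Fin N) :
          Set (GL (Fin N) (AdeleRing (𝓞 L) L))) →
        IsCompact Z → Z ⊆ Set.range (posRealScalar N L) →
        ∫⁻ g in Z * (Ω * siegelCone N L t *
            (standardMaximalCompactGL N L : Set (GL (Fin N) (AdeleRing (𝓞 L) L)))),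
          (({h : Matrix (Fin N) (Fin N) L | (h.map (cmConjRingHom L))ᵀ = h ∧
              (Godement.conjAct L).act (h.map (algebraMap L (AdeleRing (𝓞 L) L))) g ∈ B}.ncard :
                ℕ) : ℝ≥0∞) ∂μ < ⊤) :
    ∃ μ' : Measure (cmDatum L N H).automorphicQuotient, (cmDatum L N H).IsAutomorphicMeasure μ' := by
  classical
  letI mU : MeasurableSpace (adelicUnitaryGroup L H) := borel _
  haveI bU : BorelSpace (adelicUnitaryGroup L H) := ⟨rfl⟩
  set ν : Measure (adelicUnitaryGroup L H) := haar with hν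
  haveI : PolishSpace (adelicUnitaryGroup L H) :=
    Literature.Topology.Metrizable.polishSpace_of_locallyCompactSpace_of_secondCountableTopology _
  haveI : Countable (adelicUnitaryRat L H) := by
    haveI : SecondCountableTopology (adelicUnitaryRat L H) :=
      TopologicalSpace.Subtype.secondCountableTopology _
    exact countable_of_Lindelof_of_discrete
  -- a strict Borel fundamental domain for the left action of `U(H)(L⁺)`
  obtain ⟨F_U, hFUm, hFUs⟩ :=
    Literature.MeasureTheory.Group.Subgroup.exists_measurableSet_existsUnique_smul_mem
      (adelicUnitaryRat L H)
  have hFU : IsFundamentalDomain (adelicUnitaryRat L H) F_U ν :=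
    IsFundamentalDomain.mk' hFUm.nullMeasurableSet hFUs
  -- finite covolume
  have htop : ν F_U < ∞ := measure_lt_top_of_orbitCount hH hdet hcount ν hFUm hFU
  -- positive covolume: the translates of `F_U` cover `U(H)(𝔸)`
  have h0 : ν F_U ≠ 0 := by
    intro h0
    have hcov : (⋃ γ : adelicUnitaryRat L H, γ • F_U) = Set.univ := by
      refine Set.eq_univ_of_forall fun u => ?_
      obtain ⟨γ, hγ, -⟩ := hFUs u
      refine Set.mem_iUnion.2 ⟨γ⁻¹, ?_⟩
      rw [Set.mem_smul_set_iff_inv_smul_mem, inv_inv]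
      exact hγ
    have hnull : ν (⋃ γ : adelicUnitaryRat L H, γ • F_U) = 0 :=
      measure_iUnion_null fun γ => by rw [measure_smul]; exact h0
    rw [hcov] at hnull
    exact (isOpen_univ.measure_ne_zero ν Set.univ_nonempty) hnull
  -- unimodularity, inversion invariance
  have hΔ : ∀ g : adelicUnitaryGroup L H, modularCharacter g = 1 := fun g =>
    modularCharacterFun_eq_one_of_isFundamentalDomain (adelicUnitaryRat L H) ν hFU h0 htop.ne g
  haveI : ν.IsMulRightInvariant :=
    isMulRightInvariant_of_isFundamentalDomain (adelicUnitaryRat L H) ν hFU h0 htop.ne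
  haveI : ν.IsInvInvariant := isInvInvariant_of_isMulRightInvariant ν
  -- the cover `F_U⁻¹ · U(H)(L⁺) = U(H)(𝔸)`
  have hcov : (cmDatum L N H).toAutomorphicQuotient '' F_U⁻¹ = Set.univ := by
    refine Set.eq_univ_of_forall fun q => ?_
    induction q using QuotientGroup.induction_on with
    | H u =>
      obtain ⟨v, rfl⟩ : ∃ v : adelicUnitaryGroup L H, v = u := ⟨u, rfl⟩
      obtain ⟨γ, hγ, -⟩ := hFUs v⁻¹
      rw [Subgroup.smul_def, smul_eq_mul] at hγ
      refine ⟨v * (γ : adelicUnitaryGroup L H)⁻¹, ?_, ?_⟩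
      · show ((v * (γ : adelicUnitaryGroup L H)⁻¹)⁻¹ : adelicUnitaryGroup L H) ∈ F_U
        rw [_root_.mul_inv_rev, inv_inv]
        exact hγ
      · show (QuotientGroup.mk (v * (γ : adelicUnitaryGroup L H)⁻¹) :
            (cmDatum L N H).Adelic ⧸ (cmDatum L N H).quotientSubgroup) = QuotientGroup.mk v
        refine QuotientGroup.mk_mul_of_mem v ?_
        rw [cmDatum_quotientSubgroup]
        exact (adelicUnitaryRat L H).inv_mem γ.2
  have hfin : ν F_U⁻¹ < ∞ := by
    rw [measure_inv]
    exact htop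
  have hν : ν.IsHaarMeasure := inferInstance
  exact @exists_isAutomorphicMeasure_cmDatum_of_cover L _ _ _ N H mU bU (fun γ _ => hΔ γ) ν hν _
    hcov hfin

end UnitaryGroup

end Literature.NumberTheory.Automorphic

end
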